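import Summits.AtomisticToContinuum.Crystallization.Theorems.FrustratedLawDichotomyStrainedPatchHomLeafPoints

/-!
# Leaf soundness, points form, with a PARAMETRISED box (ENTRY-NATIVE first-order penalty) — def-free

decomp-a2c hand-2 g24 (crux `AperiodicFrustratedLawGap`, stmt-AtomisticToContinuum-27623; the evaluator lever named by critic row 864 (4) /
hand-1 g21 memo §6 «λ-absorption», made precise by the hcp table-leaf pilot: at identity-hcp the binding term of the leaf inequality is the
COORDINATE-WISE first-order penalty `Σⱼ |gⱼ| wⱼ` over the ten extended-Gram classes (0.024 at entry half-width 2⁻⁹ against a slack of 0.031), while the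
same gradient pulled back to the twelve ENTRY coordinates costs 0.0046 — the off-diagonal entry derivatives of the energy vanish by symmetry and the
hydrostatic combination is taken signed; float model `entry_native.py` in the hand-2 g24 memo).

★★ `leaf_sound_points_param`: hand-1's `…HomLeafPoints.leaf_sound_points` with the box hypothesis `|cᵢ − c₀ᵢ| ≤ wᵢ` replaced by a PARAMETRISATION
`cᵢ = c₀ᵢ + Σₖ Jₖᵢ uₖ + eᵢ`, `|uₖ| ≤ hwₖ`, `|eᵢ| ≤ ρᵢ` (entries `u` of the leaf box, Jacobian `J` of the coordinate map at the centre, remainder `e`):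
the first-order penalty becomes `Σₖ max|Σᵥ min/max(D·L′ᵥₖ)|·hwₖ + Σᵢ max|Σᵥ min/max(D·Lᵥᵢ)|·ρᵢ` with the PULLED-BACK functional `L′ᵥₖ = Σᵢ Lᵥᵢ Jₖᵢ`
(cancellation across coordinates AND labels before the absolute value), the radius `rᵥ = Σₖ |L′ᵥₖ| hwₖ + Σᵢ |Lᵥᵢ| ρᵢ`; everything else (table-point
expansion, certified value/derivative data, tangent parabolas) is verbatim.  `J = id`, `ρ = 0` recovers the original.  No definitions; 0 sorry;
standard axioms.  `--supports stmt-AtomisticToContinuum-27623`.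
-/

noncomputable section

namespace Summit.AtomisticToContinuum.Crystallization.Theorems.FrustratedLawDichotomyStrainedPatchHomLeafPointsParam

open scoped BigOperators
open Set Finset
open Summit.AtomisticToContinuum.Crystallization.Theorems.FrustratedLawDichotomyStrainedPatchHomCentredForm
  (tangent_parabola_le abs_linear_sub_le neg_sum_abs_mul_le_linear)
open Summit.AtomisticToContinuum.Crystallization.Theorems.FrustratedLawDichotomyStrainedPatchHomLeafPoints (min_mul_le_of_mem mul_le_max_of_mem)

/-- `|Σᵢ Lᵢ xᵢ| ≤ Σᵢ |Lᵢ| wᵢ` when `|xᵢ| ≤ wᵢ` (the centred case of `abs_linear_sub_le`). [formal bookkeeping] -/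
theorem abs_linear_le {n : ℕ} (L x w : Fin n → ℝ) (hx : ∀ i, |x i| ≤ w i) : |∑ i, L i * x i| ≤ ∑ i, |L i| * w i := by
  have h := abs_linear_sub_le L x (fun _ => 0) w (fun i => by simpa using hx i)
  simpa using h

/-- `−Σᵢ |gᵢ| wᵢ ≤ Σᵢ gᵢ xᵢ` when `|xᵢ| ≤ wᵢ` (the centred case of `neg_sum_abs_mul_le_linear`). [formal bookkeeping] -/
theorem neg_sum_abs_mul_le {n : ℕ} (g x w : Fin n → ℝ) (hx : ∀ i, |x i| ≤ w i) : -∑ i, |g i| * w i ≤ ∑ i, g i * x i := by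
  have h := neg_sum_abs_mul_le_linear g x (fun _ => 0) w (fun i => by simpa using hx i)
  simpa using h

/-- ★★ **LEAF SOUNDNESS, POINTS FORM, PARAMETRISED BOX.**  As `leaf_sound_points`, for a point `c` of the form `cᵢ = c₀ᵢ + Σₖ Jₖᵢ uₖ + eᵢ` with
`|uₖ| ≤ hwₖ`, `|eᵢ| ≤ ρᵢ`; `L′ᵥₖ := Σᵢ Lᵥᵢ Jₖᵢ`, `rᵥ := Σₖ |L′ᵥₖ| hwₖ + Σᵢ |Lᵥᵢ| ρᵢ`, `δᵥ := ℓ₀ᵥ − pᵥ`; if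
`m ≤ Σᵥ Vᵥ + Σᵥ min(Dloᵥ δᵥ)(Dhiᵥ δᵥ) − Σₖ max|Σᵥ min(Dloᵥ L′ᵥₖ)(Dhiᵥ L′ᵥₖ)| |Σᵥ max(…)|·hwₖ − Σᵢ max|Σᵥ min(Dloᵥ Lᵥᵢ)(Dhiᵥ Lᵥᵢ)| |Σᵥ max(…)|·ρᵢ − ½ Σᵥ Mᵥ(|δᵥ| + rᵥ)²`
then `m ≤ Σᵥ φᵥ(ℓᵥ c)`. [folklore: tangent parabola at `pᵥ` + interval bookkeeping in the pulled-back coordinates] -/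
theorem leaf_sound_points_param {ι : Type*} (S : Finset ι) {n q : ℕ} (L : ι → Fin n → ℝ) (φ φ' : ι → ℝ → ℝ)
    (lo hi M p V Dlo Dhi : ι → ℝ) (c₀ : Fin n → ℝ) (J : Fin q → Fin n → ℝ) (hw : Fin q → ℝ) (ρ : Fin n → ℝ) (m : ℝ)
    (hhw : ∀ k, 0 ≤ hw k) (hρ : ∀ i, 0 ≤ ρ i) (hM : ∀ v ∈ S, 0 ≤ M v)
    (hd : ∀ v ∈ S, ∀ t ∈ Icc (lo v) (hi v), HasDerivAt (φ v) (φ' v t) t)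
    (hmono : ∀ v ∈ S, MonotoneOn (fun t => φ' v t + M v * t) (Icc (lo v) (hi v)))
    (hp : ∀ v ∈ S, p v ∈ Icc (lo v) (hi v))
    (hlo : ∀ v ∈ S, lo v ≤ ∑ i, L v i * c₀ i - (∑ k, |∑ i, L v i * J k i| * hw k + ∑ i, |L v i| * ρ i))
    (hhi : ∀ v ∈ S, ∑ i, L v i * c₀ i + (∑ k, |∑ i, L v i * J k i| * hw k + ∑ i, |L v i| * ρ i) ≤ hi v)
    (hV : ∀ v ∈ S, V v ≤ φ v (p v)) (hD : ∀ v ∈ S, φ' v (p v) ∈ Icc (Dlo v) (Dhi v))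
    (hcheck : m ≤ ∑ v ∈ S, V v + ∑ v ∈ S, min (Dlo v * (∑ i, L v i * c₀ i - p v)) (Dhi v * (∑ i, L v i * c₀ i - p v))
        - ∑ k, max |∑ v ∈ S, min (Dlo v * (∑ i, L v i * J k i)) (Dhi v * (∑ i, L v i * J k i))|
            |∑ v ∈ S, max (Dlo v * (∑ i, L v i * J k i)) (Dhi v * (∑ i, L v i * J k i))| * hw k
        - ∑ i, max |∑ v ∈ S, min (Dlo v * L v i) (Dhi v * L v i)| |∑ v ∈ S, max (Dlo v * L v i) (Dhi v * L v i)| * ρ i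
        - 1 / 2 * ∑ v ∈ S, M v * (|∑ i, L v i * c₀ i - p v| + (∑ k, |∑ i, L v i * J k i| * hw k + ∑ i, |L v i| * ρ i)) ^ 2)
    (c : Fin n → ℝ) (u : Fin q → ℝ) (hu : ∀ k, |u k| ≤ hw k) (he : ∀ i, |c i - c₀ i - ∑ k, J k i * u k| ≤ ρ i) :
    m ≤ ∑ v ∈ S, φ v (∑ i, L v i * c i) := by
  -- abbreviations
  set ℓ : ι → ℝ := fun v => ∑ i, L v i * c i with hℓ
  set ℓ₀ : ι → ℝ := fun v => ∑ i, L v i * c₀ i with hℓ₀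
  set L' : ι → Fin q → ℝ := fun v k => ∑ i, L v i * J k i with hL'
  set e : Fin n → ℝ := fun i => c i - c₀ i - ∑ k, J k i * u k with hedef
  set r : ι → ℝ := fun v => ∑ k, |L' v k| * hw k + ∑ i, |L v i| * ρ i with hr
  set d : ι → ℝ := fun v => φ' v (p v) with hdφ
  have he' : ∀ i, |e i| ≤ ρ i := he
  -- the parametrisation of `ℓ v − ℓ₀ v`
  have hsplit0 : ∀ v, ℓ v - ℓ₀ v = ∑ k, L' v k * u k + ∑ i, L v i * e i := by
    intro v
    have h1 : ∀ i, c i - c₀ i = ∑ k, J k i * u k + e i := fun i => by simp only [hedef]; ring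
    calc ℓ v - ℓ₀ v = ∑ i, L v i * (c i - c₀ i) := by simp only [hℓ, hℓ₀, mul_sub, Finset.sum_sub_distrib]
      _ = ∑ i, L v i * (∑ k, J k i * u k + e i) := Finset.sum_congr rfl fun i _ => by rw [h1 i]
      _ = ∑ i, (∑ k, L v i * (J k i * u k)) + ∑ i, L v i * e i := by
          rw [← Finset.sum_add_distrib]; exact Finset.sum_congr rfl fun i _ => by rw [mul_add, Finset.mul_sum]
      _ = ∑ k, L' v k * u k + ∑ i, L v i * e i := by
          congr 1
          rw [Finset.sum_comm]
          exact Finset.sum_congr rfl fun k _ => by rw [hL', Finset.sum_mul]; exact Finset.sum_congr rfl fun i _ => by ring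
  have habs : ∀ v, |ℓ v - ℓ₀ v| ≤ r v := by
    intro v
    rw [hsplit0 v]
    exact (abs_add_le _ _).trans (add_le_add (abs_linear_le (L' v) u hw hu) (abs_linear_le (L v) e ρ he'))
  -- every term's value lies in its certified range
  have hrange : ∀ v ∈ S, ℓ v ∈ Icc (lo v) (hi v) := by
    intro v hv
    have h := habs v
    rw [abs_le] at h
    have hlo' := hlo v hv; have hhi' := hhi v hv
    exact ⟨by linarith [h.1], by linarith [h.2]⟩
  -- (0) tangent parabolas at the expansion points, summed
  have htan : ∑ v ∈ S, (φ v (p v) + d v * (ℓ v - p v) - M v / 2 * (ℓ v - p v) ^ 2) ≤ ∑ v ∈ S, φ v (ℓ v) :=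
    Finset.sum_le_sum fun v hv => tangent_parabola_le (hp v hv) (hrange v hv) (hd v hv) (hmono v hv)
  -- (1) values
  have hval : ∑ v ∈ S, V v ≤ ∑ v ∈ S, φ v (p v) := Finset.sum_le_sum hV
  -- (2) linear part
  have hsplit : ∀ v, ℓ v - p v = (ℓ₀ v - p v) + (∑ k, L' v k * u k + ∑ i, L v i * e i) := by
    intro v; rw [← hsplit0 v]; ring
  have hlin_eq : ∑ v ∈ S, d v * (ℓ v - p v) =
      ∑ v ∈ S, d v * (ℓ₀ v - p v) + ∑ k, (∑ v ∈ S, d v * L' v k) * u k + ∑ i, (∑ v ∈ S, d v * L v i) * e i := by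
    have : ∀ v ∈ S, d v * (ℓ v - p v) = d v * (ℓ₀ v - p v) + (∑ k, d v * L' v k * u k + ∑ i, d v * L v i * e i) := by
      intro v _
      rw [hsplit, mul_add, mul_add, Finset.mul_sum, Finset.mul_sum]
      congr 2
      · exact Finset.sum_congr rfl fun k _ => by ring
      · exact Finset.sum_congr rfl fun i _ => by ring
    rw [Finset.sum_congr rfl this, Finset.sum_add_distrib, Finset.sum_add_distrib, Finset.sum_comm, add_assoc]
    congr 1; congr 1
    · exact Finset.sum_congr rfl fun k _ => by rw [Finset.sum_mul]
    · rw [Finset.sum_comm]; exact Finset.sum_congr rfl fun i _ => by rw [Finset.sum_mul]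
  have hlin1 : ∑ v ∈ S, min (Dlo v * (ℓ₀ v - p v)) (Dhi v * (ℓ₀ v - p v)) ≤ ∑ v ∈ S, d v * (ℓ₀ v - p v) :=
    Finset.sum_le_sum fun v hv => min_mul_le_of_mem (hD v hv)
  have hgK : ∀ k, |∑ v ∈ S, d v * L' v k| ≤
      max |∑ v ∈ S, min (Dlo v * L' v k) (Dhi v * L' v k)| |∑ v ∈ S, max (Dlo v * L' v k) (Dhi v * L' v k)| := fun k =>
    abs_le_max_abs_abs (Finset.sum_le_sum fun v hv => min_mul_le_of_mem (hD v hv))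
      (Finset.sum_le_sum fun v hv => mul_le_max_of_mem (hD v hv))
  have hgI : ∀ i, |∑ v ∈ S, d v * L v i| ≤
      max |∑ v ∈ S, min (Dlo v * L v i) (Dhi v * L v i)| |∑ v ∈ S, max (Dlo v * L v i) (Dhi v * L v i)| := fun i =>
    abs_le_max_abs_abs (Finset.sum_le_sum fun v hv => min_mul_le_of_mem (hD v hv))
      (Finset.sum_le_sum fun v hv => mul_le_max_of_mem (hD v hv))
  have hlinK : -∑ k, max |∑ v ∈ S, min (Dlo v * L' v k) (Dhi v * L' v k)| |∑ v ∈ S, max (Dlo v * L' v k) (Dhi v * L' v k)| * hw k ≤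
      ∑ k, (∑ v ∈ S, d v * L' v k) * u k := by
    have h1 := neg_sum_abs_mul_le (fun k => ∑ v ∈ S, d v * L' v k) u hw hu
    have h2 : ∑ k, |∑ v ∈ S, d v * L' v k| * hw k ≤
        ∑ k, max |∑ v ∈ S, min (Dlo v * L' v k) (Dhi v * L' v k)| |∑ v ∈ S, max (Dlo v * L' v k) (Dhi v * L' v k)| * hw k :=
      Finset.sum_le_sum fun k _ => mul_le_mul_of_nonneg_right (hgK k) (hhw k)
    linarith
  have hlinI : -∑ i, max |∑ v ∈ S, min (Dlo v * L v i) (Dhi v * L v i)| |∑ v ∈ S, max (Dlo v * L v i) (Dhi v * L v i)| * ρ i ≤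
      ∑ i, (∑ v ∈ S, d v * L v i) * e i := by
    have h1 := neg_sum_abs_mul_le (fun i => ∑ v ∈ S, d v * L v i) e ρ he'
    have h2 : ∑ i, |∑ v ∈ S, d v * L v i| * ρ i ≤
        ∑ i, max |∑ v ∈ S, min (Dlo v * L v i) (Dhi v * L v i)| |∑ v ∈ S, max (Dlo v * L v i) (Dhi v * L v i)| * ρ i :=
      Finset.sum_le_sum fun i _ => mul_le_mul_of_nonneg_right (hgI i) (hρ i)
    linarith
  -- (3) quadratic part: `|ℓ v − p v| ≤ |ℓ₀ v − p v| + r v`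
  have hquad : ∑ v ∈ S, M v / 2 * (ℓ v - p v) ^ 2 ≤ 1 / 2 * ∑ v ∈ S, M v * (|ℓ₀ v - p v| + r v) ^ 2 := by
    rw [Finset.mul_sum]
    refine Finset.sum_le_sum fun v hv => ?_
    have h1 : |ℓ v - ℓ₀ v| ≤ r v := habs v
    have h2 : |ℓ v - p v| ≤ |ℓ₀ v - p v| + r v := by
      calc |ℓ v - p v| = |(ℓ v - ℓ₀ v) + (ℓ₀ v - p v)| := by ring_nf
        _ ≤ |ℓ v - ℓ₀ v| + |ℓ₀ v - p v| := abs_add_le _ _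
        _ ≤ |ℓ₀ v - p v| + r v := by linarith
    have hsq : (ℓ v - p v) ^ 2 ≤ (|ℓ₀ v - p v| + r v) ^ 2 := by
      calc (ℓ v - p v) ^ 2 = |ℓ v - p v| ^ 2 := (sq_abs _).symm
        _ ≤ _ := pow_le_pow_left₀ (abs_nonneg _) h2 2
    have := mul_le_mul_of_nonneg_left hsq (hM v hv)
    linarith
  -- (4) assemble
  have hsum : ∑ v ∈ S, (φ v (p v) + d v * (ℓ v - p v) - M v / 2 * (ℓ v - p v) ^ 2)
      = ∑ v ∈ S, φ v (p v) + ∑ v ∈ S, d v * (ℓ v - p v) - ∑ v ∈ S, M v / 2 * (ℓ v - p v) ^ 2 := by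
    rw [← Finset.sum_add_distrib, ← Finset.sum_sub_distrib]
  have hcheck' : m ≤ ∑ v ∈ S, V v + ∑ v ∈ S, min (Dlo v * (ℓ₀ v - p v)) (Dhi v * (ℓ₀ v - p v))
      - ∑ k, max |∑ v ∈ S, min (Dlo v * L' v k) (Dhi v * L' v k)| |∑ v ∈ S, max (Dlo v * L' v k) (Dhi v * L' v k)| * hw k
      - ∑ i, max |∑ v ∈ S, min (Dlo v * L v i) (Dhi v * L v i)| |∑ v ∈ S, max (Dlo v * L v i) (Dhi v * L v i)| * ρ i
      - 1 / 2 * ∑ v ∈ S, M v * (|ℓ₀ v - p v| + r v) ^ 2 := by simpa only [hℓ₀, hr, hL'] using hcheck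
  have htan' : ∑ v ∈ S, (φ v (p v) + d v * (ℓ v - p v) - M v / 2 * (ℓ v - p v) ^ 2) ≤ ∑ v ∈ S, φ v (∑ i, L v i * c i) := by
    simpa only [hℓ] using htan
  linarith [htan', hsum, hval, hlin_eq, hlin1, hlinK, hlinI, hquad, hcheck']

end Summit.AtomisticToContinuum.Crystallization.Theorems.FrustratedLawDichotomyStrainedPatchHomLeafPointsParam

end
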